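import Literature.NumberTheory.EllipticCurves.KugaSatoVariety
import HarnessLib

/-!
# Factoring a base change of elliptic curves through a cartesian base change

Topic: `Literature/NumberTheory/EllipticCurves`. Companion to `KugaSatoVariety.lean`. The
universal property `FullLevelModularCurve.classify` produces, for a pair `(C, ψ)` over `S₁`,
a base change `G₁ : C → E_univ` over the classifying map `S₁ → Y(N)`. To land instead in a
sub-family `E₂ → S₂` which is itself a base change of the universal one along `g₂ : S₂ → Y(N)`
(the universal curve restricted to a component `Y ↪ Y(N)_K`, fields `curve`/`curve_isBaseChange`
of `KugaSatoVariety`; or the same component again, field `sl_extends`), one factors through the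
cartesian square `(G₂, g₂)` once the classifying map factors as `f ≫ g₂`. This file proves that
the factorisation is again a base change **of group schemes with level structure**
(the "two out of three" property of `EllCurveOver.IsBaseChangeVia` and
`LevelStructure.IsBaseChangeVia`; Katz–Mazur (2.1), (3.1): base change is transitive and
cartesian squares paste):

* `IsBaseChangeVia.factor h₂ h₁ : E₁ → E₂` — the unique morphism over `f : S₁ → S₂` with
  `factor ≫ G₂ = G₁` (`factor_comp`, `factor_hom`, `factor_unique`);
* `IsBaseChangeVia.factor_point` — points compatible with `G₁` and `G₂` are compatible with
  `factor` (used for the identity sections and for `P, Q`);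
* `IsBaseChangeVia.isBaseChangeVia_factor` — `(factor, f)` is cartesian (pasting) and compatible
  with identity sections and group laws;
* `LevelStructure.IsBaseChangeVia.isBaseChangeVia_factor` — the same with level structures.

No named facts.

## References

* N. Katz, B. Mazur, *Arithmetic moduli of elliptic curves* (1985), (2.1), (3.1). [KatzMazur1985]
-/

universe u

open CategoryTheory Limits AlgebraicGeometry MonoidalCategory CartesianMonoidalCategory
open scoped MonObj

noncomputable section

namespace Literature.NumberTheory.EllipticCurves

namespace EllCurveOver

namespace IsBaseChangeVia

variable {S₁ S₂ S : Scheme.{u}} {C₁ : EllCurveOver S₁} {C₂ : EllCurveOver S₂} {C : EllCurveOver S}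
  {g₂ : S₂ ⟶ S} {G₂ : C₂.E.left ⟶ C.E.left} (h₂ : C₂.IsBaseChangeVia C g₂ G₂)
  {f : S₁ ⟶ S₂} {G₁ : C₁.E.left ⟶ C.E.left} (h₁ : C₁.IsBaseChangeVia C (f ≫ g₂) G₁)

/-- **The factorisation** of a base change `G₁ : E₁ → E` over `f ≫ g₂` through a cartesian base
change `G₂ : E₂ → E` over `g₂`: the morphism `E₁ → E₂ = S₂ ×_S E` with components
`(E₁ → S₁ → S₂, G₁)`. [folklore] -/
def factor : C₁.E.left ⟶ C₂.E.left :=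
  h₂.2.1.lift G₁ (C₁.E.hom ≫ f) (by rw [Category.assoc, h₁.1])

/-- `factor ≫ G₂ = G₁`. [folklore] -/
@[reassoc (attr := simp)]
theorem factor_comp : factor h₂ h₁ ≫ G₂ = G₁ :=
  h₂.2.1.lift_fst _ _ _

/-- `factor` lies over `f`. [folklore] -/
@[reassoc (attr := simp)]
theorem factor_hom : factor h₂ h₁ ≫ C₂.E.hom = C₁.E.hom ≫ f :=
  h₂.2.1.lift_snd _ _ _

/-- Uniqueness of the factorisation. [folklore] -/
theorem factor_unique (F : C₁.E.left ⟶ C₂.E.left) (hF : F ≫ G₂ = G₁)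
    (hF' : F ≫ C₂.E.hom = C₁.E.hom ≫ f) : F = factor h₂ h₁ :=
  h₂.2.1.hom_ext (by rw [hF, factor_comp]) (by rw [hF', factor_hom])

/-- **The factorisation is cartesian**: the square `(factor, f)` is a pullback, by pasting
(`IsPullback.of_right`). [folklore] -/
theorem isPullback_factor : IsPullback (factor h₂ h₁) C₁.E.hom C₂.E.hom f :=
  IsPullback.of_right (by simpa only [factor_comp] using h₁.2.1) (factor_hom h₂ h₁) h₂.2.1

/-- A morphism `x₁ : T → E₁` followed by `factor` equals a given `x₂ : T → E₂` as soon as the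
two agree after `G₂` (`x₁ ≫ G₁ = x₂ ≫ G₂`) and over `S₂` (`x₁ ≫ (E₁ → S₁) ≫ f = x₂ ≫ (E₂ → S₂)`):
uniqueness of morphisms into `E₂ = S₂ ×_S E`. [folklore] -/
theorem comp_factor_eq {T : Scheme.{u}} (x₁ : T ⟶ C₁.E.left) (x₂ : T ⟶ C₂.E.left)
    (hG : x₁ ≫ G₁ = x₂ ≫ G₂) (hhom : x₁ ≫ C₁.E.hom ≫ f = x₂ ≫ C₂.E.hom) :
    x₁ ≫ factor h₂ h₁ = x₂ :=
  h₂.2.1.hom_ext (by rw [Category.assoc, factor_comp, hG])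
    (by rw [Category.assoc, factor_hom, hhom])

-- `(𝟙_ (Over Sᵢ)).left = Sᵢ` by unfolding (types of sections).
set_option backward.isDefEq.respectTransparency false in
/-- **Sections compatible with `G₁` and `G₂` are compatible with `factor`**: if
`s₁ ≫ G₁ = (f ≫ g₂) ≫ s` and `s₂ ≫ G₂ = g₂ ≫ s` then `s₁ ≫ factor = f ≫ s₂`. [folklore] -/
theorem factor_point (s₁ : C₁.Sections) (s₂ : C₂.Sections) (s : C.Sections)
    (hs₁ : s₁.left ≫ G₁ = (f ≫ g₂) ≫ s.left) (hs₂ : s₂.left ≫ G₂ = g₂ ≫ s.left) :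
    s₁.left ≫ factor h₂ h₁ = f ≫ s₂.left := by
  refine comp_factor_eq h₂ h₁ _ _ (by rw [hs₁, Category.assoc, Category.assoc, hs₂]) ?_
  rw [Category.assoc, Over.w s₂, Over.w_assoc s₁]
  dsimp only [Over.tensorUnit_hom, Over.tensorUnit_left]
  rw [Category.id_comp, Category.comp_id]

-- as above, and `(_ ⊗ _).left = pullback _ _`.
set_option backward.isDefEq.respectTransparency false in
/-- **Two out of three for base changes of elliptic curves**: the factorisation of a base change
over `f ≫ g₂` through a cartesian base change over `g₂` is a base change over `f` — cartesian by
pasting, compatible with the identity sections and the group laws by the uniqueness of morphisms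
into `E₂ = S₂ ×_S E` (Katz–Mazur (2.1): base change of `E/S` is transitive).
[cite: KatzMazur1985, (2.1)] -/
theorem isBaseChangeVia_factor : C₁.IsBaseChangeVia C₂ f (factor h₂ h₁) := by
  refine ⟨factor_hom h₂ h₁, isPullback_factor h₂ h₁,
    factor_point h₂ h₁ _ _ _ h₁.2.2.1 h₂.2.2.1, ?_⟩
  -- compatibility with the group laws, tested after `G₂` and after `E₂ → S₂`
  apply h₂.2.1.hom_ext
  · rw [Category.assoc, factor_comp, h₁.2.2.2, Category.assoc, h₂.2.2.2, ← Category.assoc]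
    congr 1
    apply pullback.hom_ext
    · simp only [Category.assoc, pullback.lift_fst, pullback.lift_fst_assoc, factor_comp]
    · simp only [Category.assoc, pullback.lift_snd, pullback.lift_snd_assoc, factor_comp]
  · rw [Category.assoc, factor_hom, Category.assoc, Over.w, Over.w_assoc, Over.tensorObj_hom,
      Over.tensorObj_hom, pullback.lift_fst_assoc, Category.assoc, Category.assoc, factor_hom]

end IsBaseChangeVia

namespace LevelStructure.IsBaseChangeVia

variable {S₁ S₂ S : Scheme.{u}} {C₁ : EllCurveOver S₁} {C₂ : EllCurveOver S₂} {C : EllCurveOver S}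
  {N : ℕ} {ψ₁ : LevelStructure N C₁} {ψ₂ : LevelStructure N C₂} {φ : LevelStructure N C}
  {g₂ : S₂ ⟶ S} {G₂ : C₂.E.left ⟶ C.E.left} (h₂ : ψ₂.IsBaseChangeVia φ g₂ G₂)
  {f : S₁ ⟶ S₂} {G₁ : C₁.E.left ⟶ C.E.left} (h₁ : ψ₁.IsBaseChangeVia φ (f ≫ g₂) G₁)

/-- **Two out of three for base changes of level structures**: if `(E₂, ψ₂)` is the base
change of `(E, φ)` along `g₂` and `(E₁, ψ₁)` is its base change along `f ≫ g₂`, then `(E₁, ψ₁)`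
is the base change of `(E₂, ψ₂)` along `f`, via the factorisation `E₁ → E₂ = S₂ ×_S E`
(Katz–Mazur (3.1); this is how a classifying map into `Y(N)` that factors through a component
`Y` yields a base change from the restricted universal pair). [cite: KatzMazur1985, (3.1)] -/
theorem isBaseChangeVia_factor :
    ψ₁.IsBaseChangeVia ψ₂ f (EllCurveOver.IsBaseChangeVia.factor h₂.1 h₁.1) :=
  ⟨EllCurveOver.IsBaseChangeVia.isBaseChangeVia_factor h₂.1 h₁.1,
    EllCurveOver.IsBaseChangeVia.factor_point h₂.1 h₁.1 _ _ _ h₁.2.1 h₂.2.1,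
    EllCurveOver.IsBaseChangeVia.factor_point h₂.1 h₁.1 _ _ _ h₁.2.2 h₂.2.2⟩

/-- The factorisation followed by `G₂` is `G₁`. [folklore] -/
theorem factor_comp : EllCurveOver.IsBaseChangeVia.factor h₂.1 h₁.1 ≫ G₂ = G₁ :=
  EllCurveOver.IsBaseChangeVia.factor_comp h₂.1 h₁.1

end LevelStructure.IsBaseChangeVia

end EllCurveOver

end Literature.NumberTheory.EllipticCurves

end
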